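import Literature.Computability.AlgebraicComplexity.FlipGraph222BallCert
import HarnessLib

/-!
# A complete reduction enumerator for `(2,2,2)`-schemes over `ℤ₂` without triple coincidences (KM 2023, Def. 2 / Prop. 3)

Topic `Literature/Computability/AlgebraicComplexity`; infrastructure for kernel certificates about the
`(2,2,2)`-flip graph over `K = ℤ₂` of M. Kauers, J. Moosbauer, *Flip Graphs for Matrix
Multiplication*, ISSAC 2023 = arXiv:2212.01175 (KM), §4, complementing the verified FLIP enumerator
of `FlipGraph222BallCert.lean` (Def. 4) by a verified REDUCTION enumerator (Def. 2 / Prop. 3: KM's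
edges `E₂`), over the vocabulary of `FlipGraphConnectivity.lean` (`RedBase`, `Reduces` = Prop. 3's
construction in all six cases of Def. 2) and the `4`-bit codes of `FlipGraph222BallCert.lean`.
Everything is PROVED; no named facts.

## What is typed

* §1–§2 bookkeeping: slot permutations on codes versus tensors, positions of a code list (`picks`).
* §3 **Soundness of the flip enumerator** `flip1` / `flipsAll` of `FlipGraph222BallCert.lean`: every
  listed code list IS a flip (the tree's `Flips`) of the presented multiset (`flips_of_mem_flipsAll`;
  the companion file proved completeness).
* §4 **The merge enumerator** `mergesAll` and its COMPLETENESS under the hypothesis `sep2` ("no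
  factor code occurs three times in one slot"): over `ℤ₂`, in Prop. 3's construction the removed
  element `A⊗B₀⊗Γ₀` shares its line factor `A` with every modified element, so under `sep2` exactly
  one element `A⊗B₀⊗Γ₁` is modified (`B₀ = β B₁` forces `B₁ = B₀`), and the reduction is the MERGE
  `A⊗B₀⊗Γ₀ + A⊗B₀⊗Γ₁ = A⊗B₀⊗(Γ₀+Γ₁)` of two elements agreeing in two factors — in any of the six slot
  arrangements (`exists_mem_mergesAll_of_reduces`). (The vanishing case `Γ₀ = Γ₁` of Prop. 3, where
  the merged element is dropped, is enumerated too.)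

HONEST FRAMING: bookkeeping for finite kernel computations over `ℤ₂` and `2 × 2` matrices; the
hypothesis `sep2` is checked by `decide` on each code list it is applied to; nothing is claimed about
schemes with three elements sharing a factor, other fields or formats.

## References

* M. Kauers, J. Moosbauer, *Flip Graphs for Matrix Multiplication*, ISSAC 2023, 381–388,
  doi:10.1145/3597066.3597120, arXiv:2212.01175: Def. 2, Prop. 3 (and "We call a scheme `S'`
  constructed as above a reduction of `S`"), Def. 4, §3 (splits), §4. [KauersMoosbauer2022FlipGraphs]
-/

set_option Elab.async false

namespace Literature.Computability.AlgebraicComplexity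

open scoped BigOperators
open Multiset

namespace FlipGraph

namespace Cert222R

open Cert222

/-! ## §1 Slot permutations: codes versus tensors -/

/-- Every scalar of `ℤ₂` is `0` or `1`. [folklore] -/
private theorem zmod_two_eq : ∀ x : ZMod 2, x = 0 ∨ x = 1 := by decide

/-- Subtraction is addition over `ℤ₂` (factor matrices). [folklore] -/
private theorem sub_eq_add_F (f g : F) : f - g = f + g := by
  have h : ∀ x y : ZMod 2, x - y = x + y := by decide
  funext p; exact h _ _

/-- Subtraction is addition over `ℤ₂` (tensors). [folklore] -/
private theorem sub_eq_add_T (u v : T) : u - v = u + v := by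
  have h : ∀ x y : ZMod 2, x - y = x + y := by decide
  funext a b c; exact h _ _

/-- Addition of matrices over `ℤ₂` is `xor` of codes (re-derived from the round trip). [folklore] -/
private theorem dec_xor' (v w : ℕ) : dec (v ^^^ w) = dec v + dec w := by
  funext p
  simp only [dec, Nat.testBit_xor, Pi.add_apply]
  cases v.testBit (bitPos p) <;> cases w.testBit (bitPos p) <;> decide

/-- `dec 0 = 0`. [folklore] -/
private theorem dec_zero' : dec 0 = 0 := by
  funext p; simp [dec]

/-- Decoding is injective on codes `< 16` (kernel evaluation). [folklore] -/
private theorem dec_inj16 : ∀ v w : Fin 16, dec v.val = dec w.val → v = w := by decide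

/-- Injectivity of `dec` below `16`, unpacked. [folklore] -/
private theorem dec_injOn' {v w : ℕ} (hv : v < 16) (hw : w < 16) (h : dec v = dec w) : v = w :=
  congrArg Fin.val (dec_inj16 ⟨v, hv⟩ ⟨w, hw⟩ h)

/-- Unpacking `wfT`. [folklore] -/
private theorem wfT_iff' {p : Tri} :
    wfT p = true ↔ (0 < p.1 ∧ p.1 < 16) ∧ (0 < p.2.1 ∧ p.2.1 < 16) ∧ (0 < p.2.2 ∧ p.2.2 < 16) := by
  simp [wfT, wfC, Bool.and_eq_true, and_assoc]

/-- Unpacking `wfL`. [folklore] -/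
private theorem wfL_iff' {L : List Tri} : wfL L = true ↔ ∀ p ∈ L, wfT p = true := by
  simp [wfL, List.all_eq_true]

/-- `elts3` of a cons. [folklore] -/
private theorem elts3_cons' (p : Tri) (L : List Tri) : elts3 (p :: L) = tr3 p ::ₘ elts3 L := by
  simp [elts3]

/-- Membership in a presented multiset. [folklore] -/
private theorem mem_elts3' {L : List Tri} {t : T} : t ∈ elts3 L ↔ ∃ p ∈ L, tr3 p = t := by
  simp [elts3]

/-- `sw₁₂ (z⊗x⊗y) = x⊗z⊗y` on codes. [folklore] -/
private theorem sw₁₂_tr3' (p : Tri) : sw₁₂ (tr3 p) = tr3 (s12 p) := by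
  funext a b c; simp only [sw₁₂, tr3, s12, triad_apply]; ring
/-- `sw₁₃ (z⊗x⊗y) = y⊗x⊗z` on codes. [folklore] -/
private theorem sw₁₃_tr3' (p : Tri) : sw₁₃ (tr3 p) = tr3 (s13 p) := by
  funext a b c; simp only [sw₁₃, tr3, s13, triad_apply]; ring
/-- `sw₂₃ (z⊗x⊗y) = z⊗y⊗x` on codes. [folklore] -/
private theorem sw₂₃_tr3' (p : Tri) : sw₂₃ (tr3 p) = tr3 (s23 p) := by
  funext a b c; simp only [sw₂₃, tr3, s23, triad_apply]; ring
/-- `cyc (z⊗x⊗y) = x⊗y⊗z` on codes. [folklore] -/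
private theorem cyc_tr3' (p : Tri) : cyc (tr3 p) = tr3 (cy p) := by
  funext a b c; simp only [cyc, tr3, cy, triad_apply]; ring
/-- `cyc₂ (z⊗x⊗y) = y⊗z⊗x` on codes. [folklore] -/
private theorem cyc₂_tr3' (p : Tri) : cyc₂ (tr3 p) = tr3 (cy2 p) := by
  funext a b c; simp only [cyc₂, tr3, cy2, triad_apply]; ring

/-- Slot maps on presented multisets. [folklore] -/
private theorem elts3_map_sw₁₂' (L : List Tri) : (elts3 L).map sw₁₂ = elts3 (L.map s12) := by
  simp [elts3, Multiset.map_coe, List.map_map, Function.comp_def, sw₁₂_tr3']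
/-- Slot maps on presented multisets. [folklore] -/
private theorem elts3_map_sw₁₃' (L : List Tri) : (elts3 L).map sw₁₃ = elts3 (L.map s13) := by
  simp [elts3, Multiset.map_coe, List.map_map, Function.comp_def, sw₁₃_tr3']
/-- Slot maps on presented multisets. [folklore] -/
private theorem elts3_map_sw₂₃' (L : List Tri) : (elts3 L).map sw₂₃ = elts3 (L.map s23) := by
  simp [elts3, Multiset.map_coe, List.map_map, Function.comp_def, sw₂₃_tr3']
/-- Slot maps on presented multisets. [folklore] -/
private theorem elts3_map_cyc' (L : List Tri) : (elts3 L).map cyc = elts3 (L.map cy) := by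
  simp [elts3, Multiset.map_coe, List.map_map, Function.comp_def, cyc_tr3']
/-- Slot maps on presented multisets. [folklore] -/
private theorem elts3_map_cyc₂' (L : List Tri) : (elts3 L).map cyc₂ = elts3 (L.map cy2) := by
  simp [elts3, Multiset.map_coe, List.map_map, Function.comp_def, cyc₂_tr3']

/-- `sw₁₂` is an involution on multisets of tensors. [folklore] -/
private theorem map_sw₁₂_map_sw₁₂' (U : Multiset T) : (U.map sw₁₂).map sw₁₂ = U := by
  rw [Multiset.map_map]; exact (Multiset.map_congr rfl fun u _ => rfl).trans (Multiset.map_id U)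
/-- `sw₁₃` is an involution on multisets of tensors. [folklore] -/
private theorem map_sw₁₃_map_sw₁₃' (U : Multiset T) : (U.map sw₁₃).map sw₁₃ = U := by
  rw [Multiset.map_map]; exact (Multiset.map_congr rfl fun u _ => rfl).trans (Multiset.map_id U)
/-- `sw₂₃` is an involution on multisets of tensors. [folklore] -/
private theorem map_sw₂₃_map_sw₂₃' (U : Multiset T) : (U.map sw₂₃).map sw₂₃ = U := by
  rw [Multiset.map_map]; exact (Multiset.map_congr rfl fun u _ => rfl).trans (Multiset.map_id U)
/-- `cyc₂ ∘ cyc = id` on multisets of tensors. [folklore] -/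
private theorem map_cyc_map_cyc₂' (U : Multiset T) : (U.map cyc).map cyc₂ = U := by
  rw [Multiset.map_map]; exact (Multiset.map_congr rfl fun u _ => rfl).trans (Multiset.map_id U)
/-- `cyc ∘ cyc₂ = id` on multisets of tensors. [folklore] -/
private theorem map_cyc₂_map_cyc' (U : Multiset T) : (U.map cyc₂).map cyc = U := by
  rw [Multiset.map_map]; exact (Multiset.map_congr rfl fun u _ => rfl).trans (Multiset.map_id U)

/-- Well-formedness is slot-symmetric. [folklore] -/
private theorem wfL_map' {L : List Tri} (hL : wfL L = true) (f : Tri → Tri)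
    (hf : ∀ p, wfT p = true → wfT (f p) = true) : wfL (L.map f) = true := by
  rw [wfL_iff'] at hL ⊢
  intro p hp
  obtain ⟨q, hq, rfl⟩ := List.mem_map.mp hp
  exact hf q (hL q hq)
/-- Well-formedness under a slot permutation. [folklore] -/
private theorem wfT_s12' (p : Tri) (h : wfT p = true) : wfT (s12 p) = true := by
  rw [wfT_iff'] at h ⊢; exact ⟨h.2.1, h.1, h.2.2⟩
/-- Well-formedness under a slot permutation. [folklore] -/
private theorem wfT_s13' (p : Tri) (h : wfT p = true) : wfT (s13 p) = true := by
  rw [wfT_iff'] at h ⊢; exact ⟨h.2.2, h.2.1, h.1⟩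
/-- Well-formedness under a slot permutation. [folklore] -/
private theorem wfT_s23' (p : Tri) (h : wfT p = true) : wfT (s23 p) = true := by
  rw [wfT_iff'] at h ⊢; exact ⟨h.1, h.2.2, h.2.1⟩
/-- Well-formedness under a slot permutation. [folklore] -/
private theorem wfT_cy' (p : Tri) (h : wfT p = true) : wfT (cy p) = true := by
  rw [wfT_iff'] at h ⊢; exact ⟨h.2.1, h.2.2, h.1⟩
/-- Well-formedness under a slot permutation. [folklore] -/
private theorem wfT_cy2' (p : Tri) (h : wfT p = true) : wfT (cy2 p) = true := by
  rw [wfT_iff'] at h ⊢; exact ⟨h.2.2, h.1, h.2.1⟩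

/-! ## §2 Positions of a code list -/

/-- A pick consists of members: the picked element … [folklore] -/
private theorem mem_of_mem_picks_fst' {α : Type} {l : List α} {pr : α × List α} (h : pr ∈ picks l) :
    pr.1 ∈ l := by
  induction l generalizing pr with
  | nil => simp [picks] at h
  | cons a l ih =>
    simp only [picks, List.mem_cons, List.mem_map] at h
    rcases h with rfl | ⟨pr', hpr', rfl⟩
    · exact List.mem_cons_self
    · exact List.mem_cons_of_mem _ (ih (pr := pr') hpr')

/-- … and the pick re-assembles the list up to order. [folklore] -/
private theorem perm_of_mem_picks' {α : Type} {l : List α} {pr : α × List α} (h : pr ∈ picks l) :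
    l.Perm (pr.1 :: pr.2) := by
  induction l generalizing pr with
  | nil => simp [picks] at h
  | cons a l ih =>
    simp only [picks, List.mem_cons, List.mem_map] at h
    rcases h with rfl | ⟨pr', hpr', rfl⟩
    · exact List.Perm.refl _
    · exact ((ih hpr').cons a).trans (List.Perm.swap pr'.1 a pr'.2)

/-- … so the remaining elements are members. [folklore] -/
private theorem mem_of_mem_picks_snd' {α : Type} {l : List α} {pr : α × List α} (h : pr ∈ picks l)
    {b : α} (hb : b ∈ pr.2) : b ∈ l :=
  (perm_of_mem_picks' h).mem_iff.mpr (List.mem_cons_of_mem _ hb)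

/-- A pick splits the presented multiset: `elts3 l = tr3 pr.1 ::ₘ elts3 pr.2`. [folklore] -/
private theorem elts3_eq_cons_of_mem_picks' {l : List Tri} {pr : Tri × List Tri} (h : pr ∈ picks l) :
    elts3 l = tr3 pr.1 ::ₘ elts3 pr.2 := by
  have hp := perm_of_mem_picks' h
  rw [← elts3_cons']
  simp only [elts3]
  exact Multiset.coe_eq_coe.mpr (hp.map tr3)

/-- The whole list as a multiset of codes splits at a pick. [folklore] -/
private theorem coe_eq_cons_of_mem_picks' {l : List Tri} {pr : Tri × List Tri} (h : pr ∈ picks l) :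
    (l : Multiset Tri) = pr.1 ::ₘ (pr.2 : Multiset Tri) :=
  Multiset.coe_eq_coe.mpr (perm_of_mem_picks' h)

/-- **Bookkeeping lemma:** if the presented multiset is `t ::ₘ M`, some position of the list presents
`t` and the rest presents `M`. [folklore] -/
private theorem exists_pick_of_elts3_eq_cons' :
    ∀ (l : List Tri) (t : T) (M : Multiset T), elts3 l = t ::ₘ M →
      ∃ pr ∈ picks l, tr3 pr.1 = t ∧ elts3 pr.2 = M := by
  intro l
  induction l with
  | nil =>
    intro t M h
    exact absurd (h ▸ Multiset.mem_cons_self t M : t ∈ elts3 []) (by simp [elts3])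
  | cons a l ih =>
    intro t M h
    rw [elts3_cons', Multiset.cons_eq_cons] at h
    rcases h with ⟨hat, hM⟩ | ⟨hne, cs, hl, hM⟩
    · exact ⟨(a, l), by simp [picks], hat, hM⟩
    · obtain ⟨pr, hpr, h1, h2⟩ := ih t cs hl
      refine ⟨(pr.1, a :: pr.2), ?_, h1, ?_⟩
      · simp only [picks, List.mem_cons, List.mem_map]
        exact Or.inr ⟨pr, hpr, rfl⟩
      · rw [elts3_cons', h2, hM]

/-! ## §3 Soundness of the flip enumerator (KM Def. 4 over `ℤ₂`) -/

/-- Triads are additive in the third factor. [folklore] -/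
private theorem triad_add₃' (a b c c' : F) : triad a b (c + c') = (triad a b c + triad a b c' : T) := by
  funext x y z; simp only [triad_apply, Pi.add_apply]; ring
/-- Triads are additive in the second factor. [folklore] -/
private theorem triad_add₂' (a b b' c : F) : triad a (b + b') c = (triad a b c + triad a b' c : T) := by
  funext x y z; simp only [triad_apply, Pi.add_apply]; ring

/-- **Soundness of `flip1`:** every member of `flip1 L` is a flip with shared FIRST factor of the
presented multiset (the tree's `FlipBase`; over `ℤ₂`, `T₂ − T = T₂ + T`).
[cite: KauersMoosbauer2022FlipGraphs, Def. 4] -/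
theorem flipBase_of_mem_flip1 {L : List Tri} {r : List Tri} (hr : r ∈ flip1 L) :
    FlipBase (elts3 L) (elts3 r) := by
  simp only [flip1, List.mem_flatMap] at hr
  obtain ⟨pr, hpr, qr, hqr, hr⟩ := hr
  by_cases hz : pr.1.1 = qr.1.1
  · rw [if_pos hz] at hr
    have hS : elts3 L = triad (dec pr.1.1) (dec pr.1.2.1) (dec pr.1.2.2) ::ₘ
        triad (dec pr.1.1) (dec qr.1.2.1) (dec qr.1.2.2) ::ₘ elts3 qr.2 := by
      rw [elts3_eq_cons_of_mem_picks' hpr, elts3_eq_cons_of_mem_picks' hqr]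
      show triad (dec pr.1.1) (dec pr.1.2.1) (dec pr.1.2.2) ::ₘ
        triad (dec qr.1.1) (dec qr.1.2.1) (dec qr.1.2.2) ::ₘ elts3 qr.2 = _
      rw [hz]
    refine ⟨dec pr.1.1, dec pr.1.2.1, dec qr.1.2.1, dec pr.1.2.2, dec qr.1.2.2, elts3 qr.2, hS, ?_⟩
    simp only [List.mem_cons, List.not_mem_nil, or_false] at hr
    rcases hr with rfl | rfl
    · left
      rw [elts3_cons', elts3_cons']
      congr 1
      · show triad (dec pr.1.1) (dec pr.1.2.1) (dec (pr.1.2.2 ^^^ qr.1.2.2)) = _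
        rw [dec_xor', triad_add₃']
      · congr 1
        show triad (dec pr.1.1) (dec (pr.1.2.1 ^^^ qr.1.2.1)) (dec qr.1.2.2) = _
        rw [dec_xor', triad_add₂', sub_eq_add_T]
        exact add_comm _ _
    · right
      rw [elts3_cons', elts3_cons']
      congr 1
      · show triad (dec pr.1.1) (dec (pr.1.2.1 ^^^ qr.1.2.1)) (dec pr.1.2.2) = _
        rw [dec_xor', triad_add₂']
      · congr 1
        show triad (dec pr.1.1) (dec qr.1.2.1) (dec (pr.1.2.2 ^^^ qr.1.2.2)) = _
        rw [dec_xor', triad_add₃', sub_eq_add_T]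
        exact add_comm _ _
  · rw [if_neg hz] at hr
    simp at hr

/-- **Soundness of `flipsAll`:** every member of `flipsAll L` is a flip (the tree's `Flips`, shared
factor in any slot) of the presented multiset. [cite: KauersMoosbauer2022FlipGraphs, Def. 4 ("for any permutation of `A`, `B` and `Γ`")] -/
theorem flips_of_mem_flipsAll {L : List Tri} {r : List Tri} (hr : r ∈ flipsAll L) :
    Flips (elts3 L) (elts3 r) := by
  simp only [flipsAll, List.mem_append, List.mem_map] at hr
  rcases hr with hr | ⟨r', hr', rfl⟩ | ⟨r', hr', rfl⟩
  · exact Or.inl (flipBase_of_mem_flip1 hr)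
  · refine Or.inr (Or.inl ?_)
    rw [elts3_map_sw₁₂', elts3_map_sw₁₂', List.map_map]
    have hid : (List.map (s12 ∘ s12) r') = r' := by
      conv_rhs => rw [← List.map_id r']
      exact List.map_congr_left fun p _ => rfl
    rw [hid]
    exact flipBase_of_mem_flip1 hr'
  · refine Or.inr (Or.inr ?_)
    rw [elts3_map_sw₁₃', elts3_map_sw₁₃', List.map_map]
    have hid : (List.map (s13 ∘ s13) r') = r' := by
      conv_rhs => rw [← List.map_id r']
      exact List.map_congr_left fun p _ => rfl
    rw [hid]
    exact flipBase_of_mem_flip1 hr'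

/-! ## §4 The merge enumerator and its completeness (KM Def. 2 / Prop. 3 over `ℤ₂`) -/

/-- **Merges with the line factor in the FIRST slot and the dependent factor in the SECOND** (KM
Prop. 3's written case `A, B`, over `ℤ₂`, for a pair of positions agreeing in both codes): the
element at the second position absorbs the first, `(A, B, Γ₁ + Γ₀)`; if `Γ₁ = Γ₀` the merged element
vanishes (Prop. 3 drops it) — both readings of that degenerate case are listed.
[cite: KauersMoosbauer2022FlipGraphs, Prop. 3 (the construction) and Def. 2] -/
def merge1 (L : List Tri) : List (List Tri) :=
  (picks L).flatMap fun pr => (picks pr.2).flatMap fun qr =>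
    if pr.1.1 = qr.1.1 ∧ pr.1.2.1 = qr.1.2.1 then
      ((qr.1.1, qr.1.2.1, pr.1.2.2 ^^^ qr.1.2.2) :: qr.2) ::
        (if pr.1.2.2 ^^^ qr.1.2.2 = 0 then [qr.2] else [])
    else []

/-- **All merges** (the six cases `A,B / A,Γ / B,A / B,Γ / Γ,A / Γ,B` of Def. 2, i.e. the tree's
`Reduces`), on codes: `merge1` in the six slot arrangements, mapped back.
[cite: KauersMoosbauer2022FlipGraphs, Def. 2 and Prop. 3] -/
def mergesAll (L : List Tri) : List (List Tri) :=
  merge1 L ++ (merge1 (L.map s23)).map (List.map s23) ++ (merge1 (L.map s12)).map (List.map s12) ++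
    (merge1 (L.map cy)).map (List.map cy2) ++ (merge1 (L.map cy2)).map (List.map cy) ++
    (merge1 (L.map s13)).map (List.map s13)

/-- **No triple coincidence:** in each of the three slots, no code occurs at three positions.
[cite: KauersMoosbauer2022FlipGraphs, Def. 2 (the line condition `dim ⟨A^{(i)}⟩ = 1`)] -/
def sep2 (L : List Tri) : Bool :=
  L.all fun p =>
    decide ((L.filter fun q => q.1 = p.1).length ≤ 2) &&
    decide ((L.filter fun q => q.2.1 = p.2.1).length ≤ 2) &&
    decide ((L.filter fun q => q.2.2 = p.2.2).length ≤ 2)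

/-- The first-slot part of `sep2` (as a `Prop`). [folklore] -/
private def sep2₁ (L : List Tri) : Prop := ∀ p ∈ L, (L.filter fun q => q.1 = p.1).length ≤ 2

/-- Extracting the three slot conditions. [folklore] -/
private theorem sep2_slots {L : List Tri} (h : sep2 L = true) :
    (∀ p ∈ L, (L.filter fun q => q.1 = p.1).length ≤ 2) ∧
    (∀ p ∈ L, (L.filter fun q => q.2.1 = p.2.1).length ≤ 2) ∧
    (∀ p ∈ L, (L.filter fun q => q.2.2 = p.2.2).length ≤ 2) := by
  simp only [sep2, List.all_eq_true, Bool.and_eq_true, decide_eq_true_eq] at h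
  exact ⟨fun p hp => (h p hp).1.1, fun p hp => (h p hp).1.2, fun p hp => (h p hp).2⟩

/-- Transport of a slot condition to the first slot of a mapped list. [folklore] -/
private theorem sep2₁_map {L : List Tri} (g : Tri → ℕ) (f : Tri → Tri) (hf : ∀ p, (f p).1 = g p)
    (h : ∀ p ∈ L, (L.filter fun q => g q = g p).length ≤ 2) : sep2₁ (L.map f) := by
  intro p' hp'
  obtain ⟨p, hp, rfl⟩ := List.mem_map.mp hp'
  rw [List.filter_map, List.length_map]
  have hfun : ((fun q => decide (q.1 = (f p).1)) ∘ f) = fun q => decide (g q = g p) := by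
    funext q; simp [hf]
  rw [hfun]
  exact h p hp

/-- Two distinct members make a list of length `≥ 2`. [folklore] -/
private theorem two_le_length {α : Type} {m : List α} {a b : α} (ha : a ∈ m) (hb : b ∈ m)
    (hab : a ≠ b) : 2 ≤ m.length := by
  obtain ⟨l₁, l₂, rfl⟩ := List.append_of_mem ha
  simp only [List.length_append, List.length_cons]
  rcases List.mem_append.mp hb with h | h
  · have := List.length_pos_of_mem h; omega
  · rcases List.mem_cons.mp h with rfl | h
    · exact absurd rfl hab
    · have := List.length_pos_of_mem h; omega

/-- In a list with at most two positions carrying a given first code, after removing one of them at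
most one remains. [folklore] -/
private theorem filter_rest_le_one {L : List Tri} (hsep : sep2₁ L) {pr : Tri × List Tri}
    (hpr : pr ∈ picks L) : (pr.2.filter fun q => q.1 = pr.1.1).length ≤ 1 := by
  have hp := perm_of_mem_picks' hpr
  have h2 := hsep pr.1 (mem_of_mem_picks_fst' hpr)
  have hperm := (hp.filter fun q => q.1 = pr.1.1)
  rw [hperm.length_eq, List.filter_cons_of_pos (by simp)] at h2
  simpa using h2

/-- **Completeness of `merge1`:** over `ℤ₂`, under `sep2`, every reduction in the written case
`A, B` (the tree's `RedBase`) of the multiset presented by a well-formed code list is presented by a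
member of `merge1`. [cite: KauersMoosbauer2022FlipGraphs, Prop. 3 and Def. 2] -/
theorem exists_mem_merge1_of_redBase {L : List Tri} (hL : wfL L = true) (hsep : sep2₁ L)
    {S' : Multiset T} (h : RedBase (elts3 L) S') : ∃ r ∈ merge1 L, S' = elts3 r := by
  classical
  obtain ⟨a₀, b₀, c₀, R, Lm, L₀, hS, hA, hB, hL₀, hS'⟩ := h
  -- the removed element sits at some position `pr.1`
  obtain ⟨pr, hpr, hp1, hp2⟩ := exists_pick_of_elts3_eq_cons' L _ _ hS
  have wp : wfT pr.1 = true := wfL_iff'.mp hL _ (mem_of_mem_picks_fst' hpr)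
  obtain ⟨ea, eb, ec⟩ := triad_factors_eq_of_two zmod_two_eq hp1 (tr3_ne_zero wp)
  -- `ea : dec pr.1.1 = a₀`, `eb : dec pr.1.2.1 = b₀`, `ec : dec pr.1.2.2 = c₀`
  have bp := wfT_iff'.mp wp
  have ha₀ : a₀ ≠ 0 := by
    rw [← ea]; intro h0
    exact absurd (dec_injOn' bp.1.2 (by norm_num) (h0.trans dec_zero'.symm)) (Nat.pos_iff_ne_zero.mp bp.1.1)
  have hb₀ : b₀ ≠ 0 := by
    rw [← eb]; intro h0
    exact absurd (dec_injOn' bp.2.1.2 (by norm_num) (h0.trans dec_zero'.symm))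
      (Nat.pos_iff_ne_zero.mp bp.2.1.1)
  -- every element of `Lm + L₀` presents a member of the rest with first code `pr.1.1`
  set N : Multiset T := (Lm + L₀).map (fun q => tr q.1) with hN
  have hNle : N ≤ elts3 pr.2 := by rw [hp2]; exact Multiset.le_add_right _ _
  have hrest_wf : ∀ t ∈ pr.2, wfT t = true := fun t ht =>
    wfL_iff'.mp hL _ (mem_of_mem_picks_snd' hpr ht)
  -- factor data of the elements of `Lm + L₀`
  have hq : ∀ q ∈ Lm + L₀, ∃ t ∈ pr.2, t.1 = pr.1.1 ∧ q.2.1 = 1 ∧ q.1.1 = dec t.1 ∧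
      q.1.2.1 = dec t.2.1 ∧ q.1.2.2 = dec t.2.2 ∧ tr q.1 = tr3 t := by
    intro q hqm
    have hmem : tr q.1 ∈ elts3 pr.2 :=
      Multiset.mem_of_le hNle (Multiset.mem_map.mpr ⟨q, hqm, rfl⟩)
    obtain ⟨t, ht, htq⟩ := mem_elts3'.mp hmem
    have wt := hrest_wf t ht
    obtain ⟨e1, e2, e3⟩ := triad_factors_eq_of_two zmod_two_eq htq (tr3_ne_zero wt)
    -- the scalar `α` with `a₀ = α • A`: non-zero, hence `1`
    have hα : q.2.1 = 1 := by
      rcases zmod_two_eq q.2.1 with h0 | h1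
      · exact absurd (by rw [hA q hqm, h0, zero_smul]) ha₀
      · exact h1
    have hAq : q.1.1 = a₀ := by rw [hA q hqm, hα, one_smul]
    refine ⟨t, ht, ?_, hα, e1.symm, e2.symm, e3.symm, htq.symm⟩
    exact dec_injOn' (wfT_iff'.mp wt).1.2 bp.1.2 (e1.trans (hAq.trans ea.symm))
  -- hence all of them present the SAME rest member (at most one rest position has that first code)
  have hcnt := filter_rest_le_one hsep hpr
  have huniq : ∀ t ∈ pr.2, ∀ t' ∈ pr.2, t.1 = pr.1.1 → t'.1 = pr.1.1 → t = t' := by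
    intro t ht t' ht' h1 h1'
    by_contra hne
    have ht_f : t ∈ pr.2.filter fun q => q.1 = pr.1.1 := List.mem_filter.mpr ⟨ht, by simp [h1]⟩
    have ht'_f : t' ∈ pr.2.filter fun q => q.1 = pr.1.1 := List.mem_filter.mpr ⟨ht', by simp [h1']⟩
    have := two_le_length ht_f ht'_f hne
    omega
  -- `Lm + L₀` has exactly one element
  have hcard : Multiset.card (Lm + L₀) = 1 := by
    apply le_antisymm
    · -- two elements would present the same rest member twice, but it occurs once in `elts3 pr.2`
      by_contra hgt
      have hgt' : 1 < Multiset.card (Lm + L₀) := not_le.mp hgt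
      obtain ⟨q₁, hq₁⟩ : ∃ q, q ∈ Lm + L₀ := Multiset.card_pos_iff_exists_mem.mp (by omega)
      obtain ⟨t₁, ht₁, h11, -, -, -, -, htr₁⟩ := hq q₁ hq₁
      have hall : ∀ q ∈ Lm + L₀, tr q.1 = tr3 t₁ := by
        intro q hqm
        obtain ⟨t, ht, h1, -, -, -, -, htr⟩ := hq q hqm
        rw [htr, huniq t ht t₁ ht₁ h1 h11]
      have hNrep : N = Multiset.replicate (Multiset.card (Lm + L₀)) (tr3 t₁) := by
        rw [hN, Multiset.eq_replicate]
        refine ⟨Multiset.card_map _ _, fun x hx => ?_⟩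
        obtain ⟨q, hqm, rfl⟩ := Multiset.mem_map.mp hx
        exact hall q hqm
      have hc1 : Multiset.count (tr3 t₁) N ≤ Multiset.count (tr3 t₁) (elts3 pr.2) :=
        Multiset.count_le_of_le _ hNle
      rw [hNrep, Multiset.count_replicate_self] at hc1
      -- the rest member `t₁` occurs once among the codes, and `tr3` is injective on the rest
      have hinj : Set.InjOn tr3 {x | x ∈ (pr.2 : Multiset Tri)} := by
        intro x hx y hy hxy
        have wx := hrest_wf x (by simpa using hx)
        have wy := hrest_wf y (by simpa using hy)
        obtain ⟨f1, f2, f3⟩ := triad_factors_eq_of_two zmod_two_eq hxy (tr3_ne_zero wx)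
        have bx := wfT_iff'.mp wx; have bY := wfT_iff'.mp wy
        exact Prod.ext (dec_injOn' bx.1.2 bY.1.2 f1)
          (Prod.ext (dec_injOn' bx.2.1.2 bY.2.1.2 f2) (dec_injOn' bx.2.2.2 bY.2.2.2 f3))
      have hc2 : Multiset.count (tr3 t₁) (elts3 pr.2) = Multiset.count t₁ (pr.2 : Multiset Tri) := by
        rw [show elts3 pr.2 = Multiset.map tr3 (pr.2 : Multiset Tri) by simp [elts3]]
        exact Multiset.count_map_eq_count tr3 _ hinj t₁ (by simpa using ht₁)
      have hc3 : Multiset.count t₁ (pr.2 : Multiset Tri) ≤ 1 := by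
        rw [Multiset.count_eq_card_filter_eq]
        refine le_trans (Multiset.card_le_card
          (Multiset.monotone_filter_right (pr.2 : Multiset Tri) fun q (hq : t₁ = q) =>
            show q.1 = pr.1.1 by rw [← hq]; exact h11)) ?_
        rw [Multiset.filter_coe, Multiset.coe_card]
        exact hcnt
      omega
    · by_contra hlt
      have h0 : Lm + L₀ = 0 := Multiset.card_eq_zero.mp (by omega)
      apply hb₀
      rw [hB, h0]; simp
  -- name the single element and the rest position it presents
  obtain ⟨q, hqLL⟩ : ∃ q, Lm + L₀ = {q} := Multiset.card_eq_one.mp hcard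
  have hqm : q ∈ Lm + L₀ := by rw [hqLL]; exact Multiset.mem_singleton_self q
  obtain ⟨t, ht, ht1, hα, hq1, hq2, hq3, htrq⟩ := hq q hqm
  -- `β = 1` and the second codes agree
  have hβ : q.2.2 = 1 := by
    rcases zmod_two_eq q.2.2 with h0 | h1
    · apply absurd _ hb₀; rw [hB, hqLL]; simp [h0]
    · exact h1
  have hx : t.2.1 = pr.1.2.1 := by
    have hb : b₀ = q.1.2.1 := by rw [hB, hqLL]; simp [hβ]
    have hd : dec t.2.1 = dec pr.1.2.1 := by rw [← hq2, ← hb, eb]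
    exact dec_injOn' (wfT_iff'.mp (hrest_wf t ht)).2.1.2 bp.2.1.2 hd
  -- a member of `picks pr.2` with first component `t`
  have hqr : ∃ qr ∈ picks pr.2, qr.1 = t ∧ (pr.2 : Multiset Tri) = t ::ₘ (qr.2 : Multiset Tri) := by
    have : ∀ (l : List Tri), t ∈ l → ∃ qr ∈ picks l, qr.1 = t ∧ (l : Multiset Tri) = t ::ₘ (qr.2 : Multiset Tri) := by
      intro l
      induction l with
      | nil => intro h; simp at h
      | cons a l ih =>
        intro hmem
        rcases List.mem_cons.mp hmem with rfl | hmem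
        · exact ⟨(t, l), by simp [picks], rfl, rfl⟩
        · obtain ⟨qr, hqr, hq1', hq2'⟩ := ih hmem
          refine ⟨(qr.1, a :: qr.2), ?_, hq1', ?_⟩
          · simp only [picks, List.mem_cons, List.mem_map]; exact Or.inr ⟨qr, hqr, rfl⟩
          · show (a ::ₘ (l : Multiset Tri)) = t ::ₘ (a ::ₘ (qr.2 : Multiset Tri))
            rw [hq2', Multiset.cons_swap]
    exact this pr.2 ht
  obtain ⟨qr, hqr, hqr1, hqr2⟩ := hqr
  -- `R` is presented by the rest of that pick
  have hR : R = elts3 qr.2 := by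
    have h1 : N = {tr3 t} := by rw [hN, hqLL]; simp [htrq]
    have h2 : elts3 pr.2 = tr3 t ::ₘ elts3 qr.2 := by
      rw [elts3_eq_cons_of_mem_picks' hqr, hqr1]
    have h3 : N + R = elts3 pr.2 := hp2.symm
    rw [h1, h2, Multiset.singleton_add] at h3
    exact (Multiset.cons_inj_right _).mp h3
  -- the merged code list is listed
  have hcond : pr.1.1 = qr.1.1 ∧ pr.1.2.1 = qr.1.2.1 := by rw [hqr1]; exact ⟨ht1.symm, hx.symm⟩
  have hmem_merge : ∀ r, r ∈ ((qr.1.1, qr.1.2.1, pr.1.2.2 ^^^ qr.1.2.2) :: qr.2) ::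
      (if pr.1.2.2 ^^^ qr.1.2.2 = 0 then [qr.2] else []) → r ∈ merge1 L := fun r hr => by
    simp only [merge1, List.mem_flatMap]
    exact ⟨pr, hpr, qr, hqr, by rw [if_pos hcond]; exact hr⟩
  -- the modified element, on codes
  have hmod : triad q.1.1 q.1.2.1 (q.1.2.2 + (q.2.1 * q.2.2) • c₀) =
      tr3 (qr.1.1, qr.1.2.1, pr.1.2.2 ^^^ qr.1.2.2) := by
    rw [hα, hβ, one_mul, one_smul, hq1, hq2, hq3, ← ec, hqr1]
    show triad (dec t.1) (dec t.2.1) (dec t.2.2 + dec pr.1.2.2) =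
      triad (dec t.1) (dec t.2.1) (dec (pr.1.2.2 ^^^ t.2.2))
    rw [dec_xor', add_comm (dec pr.1.2.2) (dec t.2.2)]
  -- case split: was the modified element kept (`Lm`) or dropped (`L₀`)?
  have hLm : Lm = {q} ∧ L₀ = 0 ∨ Lm = 0 ∧ L₀ = {q} := by
    by_cases hLm0 : Lm = 0
    · right; refine ⟨hLm0, ?_⟩; rw [hLm0, zero_add] at hqLL; exact hqLL
    · left
      obtain ⟨q', hq'⟩ := Multiset.exists_mem_of_ne_zero hLm0
      have hle : {q'} ≤ Lm := Multiset.singleton_le.mpr hq'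
      have hLm_le : Lm ≤ {q} := by rw [← hqLL]; exact Multiset.le_add_right _ _
      have hq'q : q' = q := Multiset.mem_singleton.mp (Multiset.mem_of_le hLm_le hq')
      subst hq'q
      have hcardLm : Multiset.card Lm = 1 := by
        apply le_antisymm
        · simpa using Multiset.card_le_card hLm_le
        · simpa using Multiset.card_le_card hle
      have hLm1 : Lm = {q'} := by
        obtain ⟨x, hx⟩ := Multiset.card_eq_one.mp hcardLm
        rw [hx] at hq'; rw [hx, Multiset.mem_singleton.mp hq']
      refine ⟨hLm1, ?_⟩
      have := congrArg Multiset.card hqLL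
      rw [Multiset.card_add, hcardLm, Multiset.card_singleton] at this
      exact Multiset.card_eq_zero.mp (by omega)
  rcases hLm with ⟨hLm1, hL₀0⟩ | ⟨hLm0, hL₀1⟩
  · -- kept: `S' = (modified) ::ₘ R`
    refine ⟨(qr.1.1, qr.1.2.1, pr.1.2.2 ^^^ qr.1.2.2) :: qr.2, hmem_merge _ (by simp), ?_⟩
    rw [hS', hLm1, elts3_cons', ← hmod, hR]
    simp
  · -- dropped: the modified element vanishes, so its code is `0`, and `S' = R`
    have hzero := hL₀ q (by rw [hL₀1]; exact Multiset.mem_singleton_self q)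
    rw [hmod] at hzero
    have hcode : pr.1.2.2 ^^^ qr.1.2.2 = 0 := by
      by_contra hne
      have wt := wfT_iff'.mp (hrest_wf t ht)
      rw [hqr1] at hne hzero
      have hlt : pr.1.2.2 ^^^ t.2.2 < 16 := Nat.xor_lt_two_pow (n := 4) bp.2.2.2 wt.2.2.2
      have wq : wfT (t.1, t.2.1, pr.1.2.2 ^^^ t.2.2) = true :=
        wfT_iff'.mpr ⟨wt.1, wt.2.1, Nat.pos_of_ne_zero hne, hlt⟩
      exact tr3_ne_zero wq hzero
    refine ⟨qr.2, hmem_merge _ (by simp [hcode]), ?_⟩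
    rw [hS', hLm0, hR]
    simp

/-- Membership in `mergesAll` by component. [folklore] -/
private theorem mem_mergesAll {L r : List Tri}
    (h : r ∈ merge1 L ∨ r ∈ (merge1 (L.map s23)).map (List.map s23) ∨
      r ∈ (merge1 (L.map s12)).map (List.map s12) ∨ r ∈ (merge1 (L.map cy)).map (List.map cy2) ∨
      r ∈ (merge1 (L.map cy2)).map (List.map cy) ∨ r ∈ (merge1 (L.map s13)).map (List.map s13)) :
    r ∈ mergesAll L := by
  simp only [mergesAll, List.mem_append]
  tauto

/-- **Completeness of `mergesAll`:** over `ℤ₂`, for a well-formed code list without triple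
coincidences (`sep2`), every reduction (the tree's `Reduces`: KM Prop. 3's construction in all six
cases of Def. 2) of the presented multiset is presented by a member of `mergesAll`.
[cite: KauersMoosbauer2022FlipGraphs, Def. 2 and Prop. 3] -/
theorem exists_mem_mergesAll_of_reduces {L : List Tri} (hL : wfL L = true) (hsep : sep2 L = true)
    {S' : Multiset T} (h : Reduces (elts3 L) S') : ∃ r ∈ mergesAll L, S' = elts3 r := by
  obtain ⟨h₁, h₂, h₃⟩ := sep2_slots hsep
  rcases h with h | h | h | h | h | h
  · obtain ⟨r, hr, e⟩ := exists_mem_merge1_of_redBase hL h₁ h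
    exact ⟨r, mem_mergesAll (Or.inl hr), e⟩
  · rw [elts3_map_sw₂₃'] at h
    obtain ⟨r, hr, e⟩ := exists_mem_merge1_of_redBase (wfL_map' hL s23 wfT_s23')
      (sep2₁_map (fun q => q.1) s23 (fun _ => rfl) h₁) h
    refine ⟨r.map s23, mem_mergesAll (Or.inr (Or.inl (List.mem_map.mpr ⟨r, hr, rfl⟩))), ?_⟩
    rw [← map_sw₂₃_map_sw₂₃' S', e, elts3_map_sw₂₃']
  · rw [elts3_map_sw₁₂'] at h
    obtain ⟨r, hr, e⟩ := exists_mem_merge1_of_redBase (wfL_map' hL s12 wfT_s12')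
      (sep2₁_map (fun q => q.2.1) s12 (fun _ => rfl) h₂) h
    refine ⟨r.map s12, mem_mergesAll (Or.inr (Or.inr (Or.inl (List.mem_map.mpr ⟨r, hr, rfl⟩)))), ?_⟩
    rw [← map_sw₁₂_map_sw₁₂' S', e, elts3_map_sw₁₂']
  · rw [elts3_map_cyc'] at h
    obtain ⟨r, hr, e⟩ := exists_mem_merge1_of_redBase (wfL_map' hL cy wfT_cy')
      (sep2₁_map (fun q => q.2.1) cy (fun _ => rfl) h₂) h
    refine ⟨r.map cy2,
      mem_mergesAll (Or.inr (Or.inr (Or.inr (Or.inl (List.mem_map.mpr ⟨r, hr, rfl⟩))))), ?_⟩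
    rw [← map_cyc_map_cyc₂' S', e, elts3_map_cyc₂']
  · rw [elts3_map_cyc₂'] at h
    obtain ⟨r, hr, e⟩ := exists_mem_merge1_of_redBase (wfL_map' hL cy2 wfT_cy2')
      (sep2₁_map (fun q => q.2.2) cy2 (fun _ => rfl) h₃) h
    refine ⟨r.map cy,
      mem_mergesAll (Or.inr (Or.inr (Or.inr (Or.inr (Or.inl (List.mem_map.mpr ⟨r, hr, rfl⟩)))))), ?_⟩
    rw [← map_cyc₂_map_cyc' S', e, elts3_map_cyc']
  · rw [elts3_map_sw₁₃'] at h
    obtain ⟨r, hr, e⟩ := exists_mem_merge1_of_redBase (wfL_map' hL s13 wfT_s13')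
      (sep2₁_map (fun q => q.2.2) s13 (fun _ => rfl) h₃) h
    refine ⟨r.map s13,
      mem_mergesAll (Or.inr (Or.inr (Or.inr (Or.inr (Or.inr (List.mem_map.mpr ⟨r, hr, rfl⟩)))))), ?_⟩
    rw [← map_sw₁₃_map_sw₁₃' S', e, elts3_map_sw₁₃']

end Cert222R

end FlipGraph

end Literature.Computability.AlgebraicComplexity
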